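import Summits.BirchSwinnertonDyer.BirchSwinnertonDyer.Theorems.GenusKolyvaginAtTwoGenusPrimitiveSupplyAtTwoTwistSelmerTransferDown
import Summits.BirchSwinnertonDyer.BirchSwinnertonDyer.Theorems.GenusKolyvaginAtTwoGenusPrimitiveSupplyAtTwoTwistingPrimeTwin
import Summits.BirchSwinnertonDyer.Rank1Residual.X11b.KummerRelaxedStructures
import Literature.NumberTheory.EllipticCurves.InertiaTameFactorizationProofs
import HarnessLib

/-!
# Route `GenusKolyvaginAtTwo`, crux #2 `GenusPrimitiveSupplyAtTwo` (stmt-BirchSwinnertonDyer-22136):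
# Mazur–Rubin 2010 Lemma 2.11 at `p = 2` — the local Kummer condition of a quadratic twist is TRANSVERSE to
# that of the curve at an odd good prime RAMIFIED in the twisting field (kernel theorem, `φ`-free), and the
# DOWN transfer `#Sel₂(E^{(d)}) · 2 = #Sel₂(E)` with that transversality discharged

Lead seat `bsd-line-gk2-p1` g7 (cell `bsd-f1-sign2`). THEOREMS ONLY (no definition, no named fact, no `sorry`);
helper `--supports stmt-BirchSwinnertonDyer-22136`; no item is closed; BSD is not proved by any of this.

WHY. Every SUPPLY theorem of the crux on its consistent habitat (gk2-p4 g7 `exists_kolyvaginPrime_genusPair_selmer_of_cor34i`,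
gk2-p5 g6/g7 `supply_DEF1_*`, the lead's row-1 compositions `…AuxiliaryFieldRowOne*`) consumes the named print fact
`MazurRubin2010.cor34i_singleton_rat` in ONE direction: «`Sel₂(E)` not strict at the twisting prime `ℓ` ⟹
`#Sel₂(E^{(ℓ*)}) = #Sel₂(E)/2`». gk2-p5 g8 assembled that direction in the Selmer-structure currency of X11b
(`GenusKolyTwistLocal.natCard_selmerGroup_twist_mul_two_eq_of_local`, file `…TwistSelmerTransferDown`), leaving as displayed
hypotheses the two standard duality facts (Poitou–Tate with real places, Tate's local Euler characteristic) and ONE local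
statement `htr` — Mazur–Rubin's Lemma 2.11: at the odd good prime `v₀` ramified in `K(√d)/K` the transported Kummer
condition of the twist is TRANSVERSE to that of the curve, `H¹_f(K_v,E[2]) ∩ H¹_f(K_v,E^F[2]) = 0` — «NOT in the tree»
(crux workfile `Lines/genus-supply-mr-instantiation.md` §1–§2). This file PROVES it, for every number field `K`:

* §1 `exists_mem_absInertia_smul_geomSqrt_eq_neg` — for `d = c²π`, `π` a uniformiser at `v` (i.e. `v(d)` odd), some `τ`
  in the inertia group `I_{K_v}` negates `√d` (Serre's Kummer character `θ₂ : I → μ₂` of `K_v^{nr}(√π)/K_v^{nr}` is onto —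
  tree `UnramifiedKummer.exists_mem_absInertia_smul_eq_mul`; `π` is irreducible in `𝒪[K_v]`, tree
  `InertiaTame.irreducible_algebraMap`).
* §2 `exists_mem_absInertia_smul_geomPrimaryTorsion_twist_eq_neg` — for `W` good at `v ∤ 2` that `τ` acts as `-1` on
  `Wd(K̄)[2^∞]` and trivially on `W(K̄)[2^∞]`, for ANY model `Wd` of `W^{(d)}` (Silverman VII.4.1 = tree
  `smul_geomPrimaryTorsion_eq_of_mem_absInertia`; the signed isomorphism `E^{(d)}(K̄) ≃ E(K̄)` of *AEC* X.5.4, tree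
  `exists_addEquiv_geomPoints_quadraticTwist_sign` + `twistPointsIso`).
* §3 **`kummerLocalConditionAt_inf_unramifiedSubgroup_eq_bot_of_twist`** — the INTRINSIC form of Lemma 2.11 at every
  level `2^k`, `k ≥ 1`: `𝓛_{Wd}(K_v) ⊓ H¹_ur(K_v, Wd[2^k]) = ⊥`. At `v ∤ 2` the Kummer condition is
  `ker (H¹(K_v,Wd[2^k]) → H¹(K_v,Wd[2^∞]))` for ANY reduction type (X11b `LevelKummer.kummerLocalConditionAt_eq_ker_map_primaryInclusion`),
  i.e. the connecting classes `δ(b)`, `b ∈ Wd[2^∞]` (`map_primaryInclusion_restrictField_eq_zero_iff`); an unramified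
  `δ(b)` is principal on `I_{K_v}` (`mem_unramifiedSubgroup_one_iff_exists`): `σb − b = σm − m` there for some
  `m ∈ Wd[2^k]`; at `σ = τ` this is `−2b = −2m`, so `2^k b = 0` and `δ(b) = 0` (`connectingClass_eq_zero_iff`).
* §4 **`map_kummerLocalConditionAt_inf_eq_bot_of_twist_ramified`** — EXACTLY the hypothesis `htr` of
  `natCard_selmerGroup_twist_mul_two_eq_of_local`, for EVERY `Γ_K`-intertwining pair `φ : Wd[2] ⇄ W[2] : ψ`:
  `(𝓛_{Wd}(K_v)).map H¹(φ|) ⊓ 𝓛_W(K_v) = ⊥`, because `𝓛_W(K_v) = H¹_ur` at a good `v ∤ 2` (X11b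
  `KummerPT.kummerSelmerStructure_inr_eq_unramifiedSubgroup`) and `H¹(ψ|)` preserves unramified classes — the statement is
  `φ`-free, so it composes with the existential `φ` of gk2-p5's `exists_intertwining_hsplit`.
* §5 `natCard_selmerGroup_twist_mul_two_eq_of_local_of_ramified` (gk2-p5's theorem with `htr` discharged) and
  **`natCard_selmerGroup_twist_mul_two_eq_of_places`** — Mazur–Rubin Cor. 3.4 (i) DOWN for the twist pair with NO
  intertwining data and NO transversality among the hypotheses: place menu off `v₀` (split ∨ both good `∤ 2` ∨ silent;
  split ∨ `H¹ = 0` at `∞`), `#W(K_{v₀})[2] = 2`, a non-strict Selmer class, modulo {PT, Tate χ} only.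

What this does NOT do: the UP direction (strict ⟹ `#Sel₂ · 2`, needs the parity input), the cell's `K = ℚ`, `d = ℓ*`
instantiation of the place menu (every place `≠ ℓ` split / good / `∞` with `Δ < 0` — the rows of p619414/p619918), and the
two duality facts themselves. Nothing here touches the open kernel U (24947) of the crux.

References: [MazurRubin2010] B. Mazur, K. Rubin, *Ranks of twists of elliptic curves and Hilbert's tenth problem*, Invent.
Math. 181 (2010) = arXiv:0904.3709, Lemma 2.9 (p. 6), Lemma 2.11 (p. 7: «for such `v`, [Mazur 1972] or [MR visibility] show
that `N E(F_w) = 2E(K_v)`; now the first assertion follows from Lemma 2.9»), Def. 3.1, Prop. 3.3, Cor. 3.4 (i);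
[Kramer1981] K. Kramer, Trans. AMS 264 (1981), Prop. 3 and Prop. 7 (the same two inputs); [SerreInventiones1972] §1.3,
Prop. 1; [SilvermanAEC2009] Prop. VII.4.1, X.5 Cor. 5.4, Cor. X.4.4; [MilneADT2006] I §2, Thm. 2.8, Prop. 3.8, Thm. 4.10.
-/

set_option linter.dupNamespace false -- tree convention: `Summit.BirchSwinnertonDyer.BirchSwinnertonDyer.Theorems` (summit = sub-problem)
set_option autoImplicit false

noncomputable section

open scoped Classical ContRepresentation

namespace Summit.BirchSwinnertonDyer.BirchSwinnertonDyer.Theorems.GenusKolyTwistRamified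

open WeierstrassCurve Field NumberField IsDedekindDomain Function ValuativeRel
open Literature.NumberTheory.EllipticCurves Literature.NumberTheory.GaloisRepresentations
open Literature.NumberTheory.GaloisRepresentations.IsNonarchimedeanLocalField
open Literature.NumberTheory.GaloisRepresentations.DiscreteGaloisModule (SelmerStructure unramifiedSubgroup)
open Literature.NumberTheory.GaloisCohomology
open Summit.BirchSwinnertonDyer.Rank1Residual.X11b
open Summit.BirchSwinnertonDyer.Rank1Residual.X11b.LocBridge Summit.BirchSwinnertonDyer.Rank1Residual.X11b.Levels
open Summit.BirchSwinnertonDyer.Rank1Residual.X11b.CongruentTransfer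

/-! ## §1 An inertia element at `v` negating `√d` when `v(d)` is odd -/

section Inertia

variable {K : Type} [Field K] [NumberField K]

/-- **For `d = c² π` with `π` a uniformiser at `v`, some element of the inertia group `I_{K_v}` negates `√d`** (through
the restriction `Γ_{K_v} → Γ_K` along the chosen embedding `K̄ → K̄_v`): the Kummer character of the totally ramified
extension `K_v^{nr}(√π)/K_v^{nr}` is onto `μ₂` (tree `exists_mem_absInertia_smul_eq_mul`, Serre 1972 §1.3).
[cite: SerreInventiones1972, §1.3 and Prop. 1] -/
theorem exists_mem_absInertia_smul_geomSqrt_eq_neg (v : HeightOneSpectrum (𝓞 K)) {d : K} (hd : d ≠ 0)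
    (hram : ∃ π c : K, v.valuation K π = WithZero.exp (-1 : ℤ) ∧ d = c ^ 2 * π) :
    ∃ τ ∈ absInertia (v.adicCompletion K),
      absGaloisRestrict K (v.adicCompletion K) τ • geomSqrt d = -geomSqrt d := by
  obtain ⟨π, c, hπ, hdc⟩ := hram
  have hc : c ≠ 0 := by
    rintro rfl; apply hd; rw [hdc]; ring
  let F := v.adicCompletion K
  have hϖ := InertiaTame.irreducible_algebraMap v hπ
  have hKF : ∀ x : K, algebraMap K (AlgebraicClosure F) x =
      algebraMap F (AlgebraicClosure F) (algebraMap K F x) := fun x ↦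
    IsScalarTower.algebraMap_apply K F (AlgebraicClosure F) x
  set cF : AlgebraicClosure F := algebraMap F (AlgebraicClosure F) (algebraMap K F c) with hcFdef
  have hcF : cF ≠ 0 := by
    simp only [cF, ne_eq, map_eq_zero]; exact hc
  have hs2 : absClosureEmbedding K F (geomSqrt d) ^ 2 =
      cF ^ 2 * algebraMap F (AlgebraicClosure F) (algebraMap K F π) := by
    rw [← map_pow, geomSqrt_sq, AlgHom.commutes, hdc, map_mul, map_pow, hKF, hKF]
  set z : AlgebraicClosure F := absClosureEmbedding K F (geomSqrt d) * cF⁻¹ with hzdef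
  have hz : z ^ 2 = algebraMap 𝒪[F] (AlgebraicClosure F)
      ⟨algebraMap K F π, InertiaTame.algebraMap_mem_integer v hπ⟩ := by
    rw [IsScalarTower.algebraMap_apply 𝒪[F] F (AlgebraicClosure F)]
    change (absClosureEmbedding K F (geomSqrt d) * cF⁻¹) ^ 2 =
      algebraMap F (AlgebraicClosure F) (algebraMap K F π)
    rw [mul_pow, hs2, inv_pow, mul_comm (cF ^ 2), mul_inv_cancel_right₀ (pow_ne_zero 2 hcF)]
  obtain ⟨τ, hτI, hτz⟩ :=
    exists_mem_absInertia_smul_eq_mul (d := 2) two_pos hϖ hz (ζ := -1) (by norm_num)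
  refine ⟨τ, hτI, ?_⟩
  have hsz : absClosureEmbedding K F (geomSqrt d) = z * cF := by
    rw [hzdef, inv_mul_cancel_right₀ hcF]
  have hτc : τ • cF = cF := by
    rw [absoluteGaloisGroup.smul_def]; exact AlgEquiv.commutes _ _
  have key : absClosureEmbedding K F (absGaloisRestrict K F τ • geomSqrt d) =
      absClosureEmbedding K F (-geomSqrt d) := by
    rw [absGaloisRestrict_apply_smul, map_neg, hsz, smul_mul', hτz, hτc]; ring
  exact (absClosureEmbedding K F).toRingHom.injective key

end Inertia

/-! ## §2 That inertia element acts as `-1` on `E^{(d)}[2^∞]` and trivially on `E[2^∞]` -/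

section TwistAction

variable {K : Type} [Field K] [NumberField K] (W : WeierstrassCurve K) [W.IsElliptic]

/-- **At an odd good place `v` of `E` with `v(d)` odd, some `τ ∈ I_{K_v}` acts as `-1` on `E^{(d)}(K̄)[2^∞]` and
trivially on `E(K̄)[2^∞]`**, for ANY model `Wd` of the twist (`C • W^{(d)} = Wd`): `τ` negates `√d` (§1), fixes
`E[2^∞]` (good reduction, `v ∤ 2`: tree `smul_geomPrimaryTorsion_eq_of_mem_absInertia`, Silverman VII.4.1), and the
signed isomorphism `E^{(d)}(K̄) ≃ E(K̄)` (`f(σP) = ±σ f(P)` as `σ√d = ±√d`, *AEC* X.5.4, tree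
`exists_addEquiv_geomPoints_quadraticTwist_sign` + `twistPointsIso`) converts the one into the other.
[cite: SilvermanAEC2009, Prop. VII.4.1 and X.5 Cor. 5.4] [cite: MazurRubin2010, Lemma 2.11 (proof)] -/
theorem exists_mem_absInertia_smul_geomPrimaryTorsion_twist_eq_neg {d : K} (hd : d ≠ 0)
    {Wd : WeierstrassCurve K} {C : VariableChange K} (hWd : C • W.quadraticTwist d = Wd)
    (v : HeightOneSpectrum (𝓞 K)) (h2v : ((2 : ℕ) : 𝓞 K) ∉ v.asIdeal) (hW : W.HasGoodReductionAt v)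
    (hram : ∃ π c : K, v.valuation K π = WithZero.exp (-1 : ℤ) ∧ d = c ^ 2 * π) :
    ∃ τ ∈ absInertia (v.adicCompletion K),
      (∀ Q : Wd.geomPrimaryTorsion 2, absGaloisRestrict K (v.adicCompletion K) τ • Q = -Q) ∧
      (∀ P : W.geomPrimaryTorsion 2, absGaloisRestrict K (v.adicCompletion K) τ • P = P) := by
  haveI : Fact (Nat.Prime 2) := ⟨Nat.prime_two⟩
  haveI : NeZero (2 : K) := ⟨by norm_num⟩
  obtain ⟨τ, hτI, hτs⟩ := exists_mem_absInertia_smul_geomSqrt_eq_neg v hd hram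
  set g := absGaloisRestrict K (v.adicCompletion K) τ with hg
  have hfix : ∀ P : W.geomPrimaryTorsion 2, g • P = P := fun P ↦
    smul_geomPrimaryTorsion_eq_of_mem_absInertia W 2 h2v hW hτI P
  refine ⟨τ, hτI, fun Q ↦ ?_, hfix⟩
  obtain ⟨f, -, hfneg⟩ := W.exists_addEquiv_geomPoints_quadraticTwist_sign hd
  set e : geomPoints Wd ≃+ geomPoints W := (twistPointsIso hWd).symm.trans f with he
  have htw : ∀ R : geomPoints Wd, (twistPointsIso hWd).symm (g • R) = g • (twistPointsIso hWd).symm R :=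
    fun R ↦ by
    apply (twistPointsIso hWd).injective
    rw [AddEquiv.apply_symm_apply, twistPointsIso_smul, AddEquiv.apply_symm_apply]
  have hneg : ∀ R : geomPoints Wd, e (g • R) = -(g • e R) := fun R ↦ by
    simp only [he, AddEquiv.trans_apply, htw]
    exact hfneg g hτs _
  -- `e Q ∈ E[2^∞]` is fixed by `g`
  have hmem : e (Q : geomPoints Wd) ∈ W.geomPrimaryTorsion 2 := by
    obtain ⟨n, hn⟩ := (AddCommGroup.mem_primaryComponent).mp Q.2
    exact (AddCommGroup.mem_primaryComponent).mpr ⟨n, by rw [← map_nsmul, hn, map_zero]⟩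
  have hfixQ : g • e (Q : geomPoints Wd) = e Q :=
    congrArg Subtype.val (hfix ⟨e (Q : geomPoints Wd), hmem⟩)
  apply Subtype.ext
  rw [primaryComponent.coe_smul, AddSubgroup.coe_neg]
  apply e.injective
  rw [hneg, hfixQ, map_neg]

end TwistAction

/-! ## §3 Mazur–Rubin Lemma 2.11, intrinsic form: `𝓛_{E^{(d)},v} ⊓ H¹_ur(K_v, E^{(d)}[2^k]) = ⊥` -/

section Intrinsic

variable {K : Type} [Field K] [NumberField K] (W : WeierstrassCurve K) [W.IsElliptic]

/-- **Mazur–Rubin 2010 Lemma 2.11 at `p = 2`, intrinsic (`φ`-free) form, every level `2^k`, `k ≥ 1`.** Let `E = W`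
have good reduction at a finite place `v ∤ 2` of the number field `K`, let `v(d)` be odd (`d = c² π`, `π` a uniformiser
at `v`), and let `Wd` be ANY model of the quadratic twist (`C • W^{(d)} = Wd`). Then the local Kummer condition of `Wd`
at `K_v` meets the unramified subgroup trivially:
`𝓛_{Wd}(K_v) ⊓ H¹_ur(K_v, Wd[2^k]) = ⊥` in `H¹(K_v, Wd[2^k])`.
PROOF (tree currency). At `v ∤ 2` the Kummer condition is `ker (H¹(K_v, Wd[2^k]) → H¹(K_v, Wd[2^∞]))`
(`LevelKummer.kummerLocalConditionAt_eq_ker_map_primaryInclusion`, any reduction type), whose classes are the connecting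
classes `δ(b)`, `b ∈ Wd[2^∞]` with `2^k b` rational (`map_primaryInclusion_restrictField_eq_zero_iff`). By §2 some
`τ ∈ I_{K_v}` acts as `-1` on `Wd[2^∞]`. If `δ(b)` is unramified, its cocycle is principal on `I_{K_v}`
(`mem_unramifiedSubgroup_one_iff_exists`): `σ b − b = σ m − m` on `I_{K_v}` for some `m ∈ Wd[2^k]`; at `σ = τ` this reads
`−2b = −2m`, so `2^k b = 2^{k-1}·2m = 0` and `δ(b) = 0` (`connectingClass_eq_zero_iff`). This is the content of
Mazur–Rubin's proof («`N E(F_w) = 2E(K_v)` … Lemma 2.9») in the cohomological dress of the tree.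
[cite: MazurRubin2010, Lemma 2.11 (arXiv:0904.3709 p. 7)] [cite: Kramer1981, Prop. 3 and Prop. 7]
[cite: SilvermanAEC2009, Prop. VII.4.1] -/
theorem kummerLocalConditionAt_inf_unramifiedSubgroup_eq_bot_of_twist {d : K} (hd : d ≠ 0)
    {Wd : WeierstrassCurve K} [Wd.IsElliptic] {C : VariableChange K} (hWd : C • W.quadraticTwist d = Wd)
    (v : HeightOneSpectrum (𝓞 K)) (h2v : ((2 : ℕ) : 𝓞 K) ∉ v.asIdeal) (hW : W.HasGoodReductionAt v)
    (hram : ∃ π c : K, v.valuation K π = WithZero.exp (-1 : ℤ) ∧ d = c ^ 2 * π) {k : ℕ} (hk : 1 ≤ k) :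
    Wd.kummerLocalConditionAt ((2 ^ k : ℕ) : ℤ) (v.adicCompletion K) ⊓
      unramifiedSubgroup (GaloisRep.restrictField (v.adicCompletion K)
        (Wd.torsionGaloisModule ((2 ^ k : ℕ) : ℤ))) 1 = ⊥ := by
  haveI : Fact (Nat.Prime 2) := ⟨Nat.prime_two⟩
  have hn : ((2 ^ k : ℕ) : ℤ) ≠ 0 := by exact_mod_cast pow_ne_zero k two_ne_zero
  obtain ⟨τ, hτI, hτneg, -⟩ :=
    exists_mem_absInertia_smul_geomPrimaryTorsion_twist_eq_neg W hd hWd v h2v hW hram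
  rw [eq_bot_iff]
  intro c hc
  obtain ⟨hcK, hcur⟩ := AddSubgroup.mem_inf.mp hc
  rw [AddSubgroup.mem_bot]
  rw [LevelKummer.kummerLocalConditionAt_eq_ker_map_primaryInclusion Wd 2 k v h2v hn,
    AddMonoidHom.mem_ker] at hcK
  obtain ⟨b, hb, rfl⟩ :=
    (map_primaryInclusion_restrictField_eq_zero_iff Wd 2 k (v.adicCompletion K) c).mp hcK
  -- the unramified connecting class: its cocycle is principal on the inertia group
  rw [connectingClass] at hcur
  obtain ⟨m, hm⟩ := (mem_unramifiedSubgroup_one_iff_exists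
    (GaloisRep.restrictField (v.adicCompletion K) (Wd.torsionGaloisModule ((2 ^ k : ℕ) : ℤ))) _).mp hcur
  set i := (primaryInclusion Wd 2 k).restrictField (v.adicCompletion K) with hi
  have key := congrArg i (hm τ hτI)
  rw [apply_liftCocycle, Levels.cobCocycle_apply, map_sub] at key
  have him : i ((GaloisRep.restrictField (v.adicCompletion K)
      (Wd.torsionGaloisModule ((2 ^ k : ℕ) : ℤ))) τ m) =
      absGaloisRestrict K (v.adicCompletion K) τ • i m := i.isIntertwining τ m
  rw [him, hτneg (i m)] at key
  change absGaloisRestrict K (v.adicCompletion K) τ • b - b = -(i m) - i m at key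
  rw [hτneg b] at key
  -- `-b - b = -(i m) - i m`, so `2 • b = 2 • i m` and `2^k • b = 0`
  have h2 : 2 • b = 2 • i m := by
    have h' : -(b + b) = -(i m + i m) := by rw [neg_add, neg_add]; exact key
    rw [two_nsmul, two_nsmul]
    exact neg_injective h'
  have hkb : 2 ^ k • b = 0 := by
    obtain ⟨j, hj⟩ := Nat.exists_eq_add_of_le hk
    have hpow : 2 ^ k = 2 ^ j * 2 := by rw [hj, Nat.add_comm, pow_succ]
    rw [hpow, mul_smul, h2, ← mul_smul, ← hpow, ← map_nsmul, pow_nsmul_geomTorsion_eq_zero Wd 2 k m,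
      map_zero]
  exact (connectingClass_eq_zero_iff (primaryInclusion_restrictField_injective Wd 2 k _)
    (pow_nsmul_geomTorsion_eq_zero Wd 2 k) b hb).mpr ⟨0, fun σ ↦ map_zero _, by rw [smul_zero, hkb]⟩

end Intrinsic

/-! ## §4 Mazur–Rubin Lemma 2.11 in X11b's transport currency: the hypothesis `htr` of
`natCard_selmerGroup_twist_mul_two_eq_of_local`, for EVERY intertwining `φ : E^{(d)}[2] ⇄ E[2]` -/

section Transverse

variable {K : Type} [Field K] [NumberField K] (W : WeierstrassCurve K) [W.IsElliptic]

/-- **At a good `v ∤ 2` the level-`2` Kummer condition of `E` is the unramified subgroup** (`((2 : ℕ) : ℤ)` spelling of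
X11b's `KummerPT.kummerSelmerStructure_inr_eq_unramifiedSubgroup` at `p = 2`, `k = 1`).
[cite: SilvermanAEC2009, Cor. X.4.4] [cite: MilneADT2006, Ch. I Prop. 3.8] -/
theorem kummerLocalConditionAt_two_eq_unramifiedSubgroup (v : HeightOneSpectrum (𝓞 K))
    (h2v : ((2 : ℕ) : 𝓞 K) ∉ v.asIdeal) (hW : W.HasGoodReductionAt v) :
    W.kummerLocalConditionAt ((2 : ℕ) : ℤ) (v.adicCompletion K) =
      unramifiedSubgroup (GaloisRep.restrictField (v.adicCompletion K)
        (W.torsionGaloisModule ((2 : ℕ) : ℤ))) 1 := by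
  haveI : Fact (Nat.Prime 2) := ⟨Nat.prime_two⟩
  have h := KummerPT.kummerSelmerStructure_inr_eq_unramifiedSubgroup W 2 1 h2v hW
  rw [pow_one, WeierstrassCurve.kummerSelmerStructure_apply] at h
  exact h

/-- **Mazur–Rubin 2010 Lemma 2.11 at `p = 2` as the transversality hypothesis `htr` of gk2-p5's
`natCard_selmerGroup_twist_mul_two_eq_of_local` (…TwistSelmerTransferDown), for EVERY `Γ_K`-intertwining pair
`φ : Wd[2] ⇄ W[2] : ψ` with `ψ ∘ φ = id`.** For `W` with good reduction at a finite `v ∤ 2`, `v(d)` odd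
(`d = c² π`, `π` a uniformiser at `v`) and any model `Wd` of `W^{(d)}`:
`(𝓛_{Wd}(K_v)).map H¹(φ|_{K_v}) ⊓ 𝓛_W(K_v) = ⊥` — the transported local Kummer condition of the twist is
TRANSVERSE to the Kummer condition of the curve at the ramified prime. Proof: `𝓛_W(K_v) = H¹_ur` (good reduction,
`v ∤ 2`), `H¹(ψ|)` carries unramified classes to unramified classes and undoes `H¹(φ|)`, so a class in the intersection
pulls back to `𝓛_{Wd}(K_v) ⊓ H¹_ur(K_v, Wd[2]) = ⊥` (§3, `k = 1`). Independent of `φ` because `H¹_ur` is intrinsic.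
[cite: MazurRubin2010, Lemma 2.11 and Def. 3.1 (arXiv:0904.3709 pp. 7, 9)] [cite: Kramer1981, Prop. 3 and Prop. 7] -/
theorem map_kummerLocalConditionAt_inf_eq_bot_of_twist_ramified {d : K} (hd : d ≠ 0)
    {Wd : WeierstrassCurve K} [Wd.IsElliptic] {C : VariableChange K} (hWd : C • W.quadraticTwist d = Wd)
    (v : HeightOneSpectrum (𝓞 K)) (h2v : ((2 : ℕ) : 𝓞 K) ∉ v.asIdeal) (hW : W.HasGoodReductionAt v)
    (hram : ∃ π c : K, v.valuation K π = WithZero.exp (-1 : ℤ) ∧ d = c ^ 2 * π)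
    (φ : (Wd.torsionGaloisModule ((2 : ℕ) : ℤ)).toContRepresentation →ⁱL
      (W.torsionGaloisModule ((2 : ℕ) : ℤ)).toContRepresentation)
    (ψ : (W.torsionGaloisModule ((2 : ℕ) : ℤ)).toContRepresentation →ⁱL
      (Wd.torsionGaloisModule ((2 : ℕ) : ℤ)).toContRepresentation)
    (hψφ : ∀ a, ψ (φ a) = a) :
    (Wd.kummerLocalConditionAt ((2 : ℕ) : ℤ) (v.adicCompletion K)).map
        (galoisCohomology.map (φ.restrictField (v.adicCompletion K)) 1) ⊓
      W.kummerLocalConditionAt ((2 : ℕ) : ℤ) (v.adicCompletion K) = ⊥ := by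
  have h1 := kummerLocalConditionAt_inf_unramifiedSubgroup_eq_bot_of_twist W hd hWd v h2v hW hram le_rfl
  rw [pow_one] at h1
  rw [kummerLocalConditionAt_two_eq_unramifiedSubgroup W v h2v hW, eq_bot_iff]
  intro x hx
  obtain ⟨⟨y, hy, rfl⟩, hxur⟩ := AddSubgroup.mem_inf.mp hx
  rw [AddSubgroup.mem_bot]
  -- pull back along `ψ`: `y` is unramified and lies in `𝓛_{Wd}`
  have hyur : y ∈ unramifiedSubgroup (GaloisRep.restrictField (v.adicCompletion K)
      (Wd.torsionGaloisModule ((2 : ℕ) : ℤ))) 1 := by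
    have h := map_mem_unramifiedSubgroup (ψ.restrictField (v.adicCompletion K)) hxur
    have e : galoisCohomology.map (ψ.restrictField (v.adicCompletion K)) 1
        (galoisCohomology.map (φ.restrictField (v.adicCompletion K)) 1 y) = y :=
      map_restrictField_map_restrictField_of_comp_eq φ ψ hψφ (Sum.inr v) y
    rwa [e] at h
  have hy0 : y = 0 := by
    rw [← AddSubgroup.mem_bot, ← h1]
    exact AddSubgroup.mem_inf.mpr ⟨hy, hyur⟩
  rw [hy0, map_zero]

end Transverse

/-! ## §5 Consequence: `#Sel₂(E^{(d)}) · 2 = #Sel₂(E)` from the local rows with the transversality PROVED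
(Mazur–Rubin Cor. 3.4 (i) DOWN for the twist pair, modulo Poitou–Tate and Tate's local Euler characteristic only) -/

section Down

variable {K : Type} [Field K] [NumberField K] (W : WeierstrassCurve K) [W.IsElliptic]

/-- **gk2-p5's `natCard_selmerGroup_twist_mul_two_eq_of_local` with its hypothesis `htr` DISCHARGED** (§4): for `W` good at
the odd place `v₀` with `v₀(d)` odd and a model `Wd` of `W^{(d)}`, given the print facts `hPT`, `hEP`, an intertwining pair
`φ, ψ` with the split-place agreement `hsplit`, the place menu `hfin`/`hinf` off `v₀`, `#W(K_{v₀})[2] = 2` and a Selmer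
class of `W` not strict at `v₀`: `#Sel₂(Wd) · 2 = #Sel₂(W)`.
[cite: MazurRubin2010, Lemma 2.11, Prop. 3.3 and Cor. 3.4 (i)] [cite: MilneADT2006, Ch. I, Thm. 4.10] -/
theorem natCard_selmerGroup_twist_mul_two_eq_of_local_of_ramified
    (hPT : poitouTate_selmerStructure_duality_real K)
    (hEP : ∀ v : HeightOneSpectrum (𝓞 K), localEulerPoincareCharacteristic (v.adicCompletion K))
    {d : K} (hd : d ≠ 0) {Wd : WeierstrassCurve K} [Wd.IsElliptic] {C : VariableChange K}
    (hWd : C • W.quadraticTwist d = Wd)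
    (φ : (Wd.torsionGaloisModule ((2 : ℕ) : ℤ)).toContRepresentation →ⁱL
      (W.torsionGaloisModule ((2 : ℕ) : ℤ)).toContRepresentation)
    (ψ : (W.torsionGaloisModule ((2 : ℕ) : ℤ)).toContRepresentation →ⁱL
      (Wd.torsionGaloisModule ((2 : ℕ) : ℤ)).toContRepresentation)
    (hψφ : ∀ a, ψ (φ a) = a) (hφψ : ∀ b, φ (ψ b) = b)
    (hsplit : ∀ (E : Type) [Field E] [Algebra K E], (∃ s : E, s ^ 2 = algebraMap K E d) →
      (Wd.kummerLocalConditionAt ((2 : ℕ) : ℤ) E).map (galoisCohomology.map (φ.restrictField E) 1) =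
        W.kummerLocalConditionAt ((2 : ℕ) : ℤ) E)
    (v₀ : HeightOneSpectrum (𝓞 K)) (hv₀ : ((2 : ℕ) : 𝓞 K) ∉ v₀.asIdeal) (hW : W.HasGoodReductionAt v₀)
    (hram : ∃ π c : K, v₀.valuation K π = WithZero.exp (-1 : ℤ) ∧ d = c ^ 2 * π)
    (hfin : ∀ v : HeightOneSpectrum (𝓞 K), v ≠ v₀ →
      (∃ s : v.adicCompletion K, s ^ 2 = algebraMap K (v.adicCompletion K) d) ∨
      (((2 : ℕ) : 𝓞 K) ∉ v.asIdeal ∧ W.HasGoodReductionAt v ∧ Wd.HasGoodReductionAt v) ∨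
      (((2 : ℕ) : 𝓞 K) ∉ v.asIdeal ∧
        Nat.card (nsmulAddMonoidHom 2 : (W.baseChange (v.adicCompletion K)).toAffine.Point →+ _).ker = 1 ∧
        Nat.card (nsmulAddMonoidHom 2 : (Wd.baseChange (v.adicCompletion K)).toAffine.Point →+ _).ker = 1))
    (hinf : ∀ w : InfinitePlace K,
      (∃ s : w.Completion, s ^ 2 = algebraMap K w.Completion d) ∨
      ((∀ x : galoisCohomology (W.localGaloisModule w.Completion) 1, x = 0) ∧
        (∀ x : galoisCohomology (Wd.localGaloisModule w.Completion) 1, x = 0)))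
    (ht : Nat.card (nsmulAddMonoidHom 2 : (W.baseChange (v₀.adicCompletion K)).toAffine.Point →+ _).ker = 2)
    (hns : ∃ c ∈ (W.kummerSelmerStructure ((2 : ℕ) : ℤ)).selmerGroup,
      galoisCohomology.localization (W.torsionGaloisModule ((2 : ℕ) : ℤ)) (Sum.inr v₀) 1 c ≠ 0) :
    Nat.card (Wd.selmerGroup ((2 : ℕ) : ℤ)) * 2 = Nat.card (W.selmerGroup ((2 : ℕ) : ℤ)) :=
  GenusKolyTwistLocal.natCard_selmerGroup_twist_mul_two_eq_of_local W Wd d hPT hEP φ ψ hψφ hφψ hsplit v₀ hv₀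
    hfin hinf (map_kummerLocalConditionAt_inf_eq_bot_of_twist_ramified W hd hWd v₀ hv₀ hW hram φ ψ hψφ) ht hns

/-- **Mazur–Rubin Cor. 3.4 (i), DOWN direction, for the quadratic-twist pair `(E, E^{(d)})` at `p = 2` — NO intertwining
data and NO transversality in the hypotheses.** For `W` elliptic over a number field `K` with good reduction at a finite
`v₀ ∤ 2`, `d ≠ 0` with `v₀(d)` odd (`d = c² π`, `π` a uniformiser at `v₀`), and ANY elliptic model `Wd` of `W^{(d)}`:
IF every finite `v ≠ v₀` is split (`d ∈ (K_v^×)²`) or good for both curves with `v ∤ 2` or silent (`v ∤ 2`, no `K_v`-rational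
`2`-torsion on either curve), every infinite place is split or has `H¹(K_w, ·) = 0` for both curves, `#W(K_{v₀})[2] = 2`, and
`Sel₂(W)` has a class with non-zero localisation at `v₀`, THEN `#Sel₂(Wd) · 2 = #Sel₂(W)` — granted only the two standard
print facts `poitouTate_selmerStructure_duality_real K` (Milne ADT I.4.10 + real places) and `localEulerPoincareCharacteristic`
(Tate). The intertwining pair and the split-place agreement come from gk2-p5's `exists_intertwining_hsplit` (Lemma 2.10 (i));
the transversality at `v₀` is §4 (Lemma 2.11). For the cell (`K = ℚ`, `Δ(W) < 0`, `d = ℓ* = −ℓ` at a Kolyvagin prime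
`ℓ ≡ 7 (8)` with `(−ℓ/p) = 1` for `p ∣ N`) this is the DOWN half of `MazurRubin2010.cor34i_singleton_rat` that the SUPPLY
consumes (gk2-p4 `exists_kolyvaginPrime_genusPair_selmer_of_cor34i`, gk2-p5 `supply_DEF1_*`), now modulo {PT, Tate χ} only.
[cite: MazurRubin2010, Lemmas 2.10–2.11, Prop. 3.3, Cor. 3.4 (i) (arXiv:0904.3709 pp. 6–10)]
[cite: MilneADT2006, Ch. I, Thm. 2.8 and Thm. 4.10] -/
theorem natCard_selmerGroup_twist_mul_two_eq_of_places
    (hPT : poitouTate_selmerStructure_duality_real K)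
    (hEP : ∀ v : HeightOneSpectrum (𝓞 K), localEulerPoincareCharacteristic (v.adicCompletion K))
    {d : K} (hd : d ≠ 0) {Wd : WeierstrassCurve K} [Wd.IsElliptic] {C : VariableChange K}
    (hWd : C • W.quadraticTwist d = Wd)
    (v₀ : HeightOneSpectrum (𝓞 K)) (hv₀ : ((2 : ℕ) : 𝓞 K) ∉ v₀.asIdeal) (hW : W.HasGoodReductionAt v₀)
    (hram : ∃ π c : K, v₀.valuation K π = WithZero.exp (-1 : ℤ) ∧ d = c ^ 2 * π)
    (hfin : ∀ v : HeightOneSpectrum (𝓞 K), v ≠ v₀ →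
      (∃ s : v.adicCompletion K, s ^ 2 = algebraMap K (v.adicCompletion K) d) ∨
      (((2 : ℕ) : 𝓞 K) ∉ v.asIdeal ∧ W.HasGoodReductionAt v ∧ Wd.HasGoodReductionAt v) ∨
      (((2 : ℕ) : 𝓞 K) ∉ v.asIdeal ∧
        Nat.card (nsmulAddMonoidHom 2 : (W.baseChange (v.adicCompletion K)).toAffine.Point →+ _).ker = 1 ∧
        Nat.card (nsmulAddMonoidHom 2 : (Wd.baseChange (v.adicCompletion K)).toAffine.Point →+ _).ker = 1))
    (hinf : ∀ w : InfinitePlace K,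
      (∃ s : w.Completion, s ^ 2 = algebraMap K w.Completion d) ∨
      ((∀ x : galoisCohomology (W.localGaloisModule w.Completion) 1, x = 0) ∧
        (∀ x : galoisCohomology (Wd.localGaloisModule w.Completion) 1, x = 0)))
    (ht : Nat.card (nsmulAddMonoidHom 2 : (W.baseChange (v₀.adicCompletion K)).toAffine.Point →+ _).ker = 2)
    (hns : ∃ c ∈ (W.kummerSelmerStructure ((2 : ℕ) : ℤ)).selmerGroup,
      galoisCohomology.localization (W.torsionGaloisModule ((2 : ℕ) : ℤ)) (Sum.inr v₀) 1 c ≠ 0) :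
    Nat.card (Wd.selmerGroup ((2 : ℕ) : ℤ)) * 2 = Nat.card (W.selmerGroup ((2 : ℕ) : ℤ)) := by
  haveI : NeZero (2 : K) := ⟨by norm_num⟩
  obtain ⟨φ, ψ, hψφ, hφψ, hsplit⟩ := GenusKolyTwistLocal.exists_intertwining_hsplit W hd hWd
  exact natCard_selmerGroup_twist_mul_two_eq_of_local_of_ramified W hPT hEP hd hWd φ ψ hψφ hφψ hsplit v₀ hv₀ hW
    hram hfin hinf ht hns

end Down

end Summit.BirchSwinnertonDyer.BirchSwinnertonDyer.Theorems.GenusKolyTwistRamified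

end
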